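import Mathlib

/-!
# Framed families: the Marica–Schönheim pencil over every field, and the structure of all Z/Y-relations

Helper file for crux `stmt-CriticalPhenomena-4575` (`NoHeavyLowerTail`, route `PercNearOneGluingNoHeavy`),
new-inequality factory seat `prim-ineq-gen-3` (gen 21).  Everything here is PROVED; no definitions.

Notation (memo `run/shared/lean/prim/prim-ineq-gen-3/CONJECTURE-P2.md` §10): for a finite family `𝒜`, `D = 𝒜 \\ 𝒜`,
`Z A E = [E ⊆ A]`, `Y A E = [E ∩ A = ∅]`; a RELATION is a pair `(λ, μ)` of coefficient vectors with `λ Z = μ Y` on `D`.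
Call `𝒜` FRAMED (by `T`) if `∅ ∈ 𝒜`, `T ∈ 𝒜` and every member lies in `T`.

* `eq_zero_of_sum_supsets_eq_zero` — the zeta matrix `[Y ⊆ X]` of a finite family of sets is invertible: if
  `∑_{X ∈ ℬ, X ⊇ Y} κ X = 0` for every `Y ∈ ℬ` then `κ` vanishes on `ℬ`.
* `framed_relation` — **THEOREM F.**  For a framed family every relation is a complement transport: if `λ Z = μ Y` on `D`, then
  `λ A = μ A = 0` whenever `T \ A ∉ 𝒜`, and `μ A = λ (T \ A)` whenever `T \ A ∈ 𝒜`.  [The function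
  `K = ∑_A λ_A ζ'_A - ∑_A μ_A ζ'_{T \ A}`, `ζ'_X(Y) = [Y ⊆ X]`, vanishes on the member columns `B = B \ ∅` and the co-member columns
  `T \ B`, i.e. on `ℬ = 𝒜 ∪ {T \ A}`, and `(ζ'_X(Y))_{X,Y ∈ ℬ}` is the zeta matrix of `ℬ`.]
* `twoChain_of_framed` — hence framed families have the 2-chain periodicity property P2 (`λZ = μY`, `μZ = νY` ⟹ `λ = ν`), and
* `linearIndependent_pencil_of_framed` — the pencil rows `A ↦ (E ↦ [E ⊆ A] + t [E ∩ A = ∅])` over `𝒜 \\ 𝒜` are linearly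
  independent over EVERY field for every `t` with `t * t ≠ 1` (a dependency `c` is the relation `(c, -t c)`, so `c_A = t² c_A`).

Via the union-pushforward `A ↦ A ∪ B` this also yields full reciprocity, P2 and the pencil theorem for every UNION-CLOSED (dually:
intersection-closed) family (memo §10, Corollary U; not formalised here).  (prim-ineq-gen-3 gen 21, 2026-08-23.)
-/

namespace Summit.CriticalPhenomena.PercolationContinuityZ3.Theorems

namespace OrderedDifferences

open Finset
open scoped FinsetFamily

variable {α : Type*} [DecidableEq α] {K : Type*} [Field K]

/-- **The zeta matrix of a finite set family is invertible.**  If `κ` satisfies `∑_{X ∈ ℬ, Y ⊆ X} κ X = 0` for every `Y ∈ ℬ`,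
then `κ X = 0` for every `X ∈ ℬ` (look at a member of maximal cardinality among those with `κ ≠ 0`). -/
theorem eq_zero_of_sum_supsets_eq_zero (ℬ : Finset (Finset α)) (κ : Finset α → K)
    (h : ∀ Y ∈ ℬ, ∑ X ∈ ℬ.filter (fun X => Y ⊆ X), κ X = 0) : ∀ X ∈ ℬ, κ X = 0 := by
  classical
  let S : Finset (Finset α) := ℬ.filter (fun X => κ X ≠ 0)
  rcases S.eq_empty_or_nonempty with hS | hS
  · intro X hX
    by_contra hκ
    have : X ∈ S := mem_filter.mpr ⟨hX, hκ⟩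
    rw [hS] at this
    exact absurd this (Finset.notMem_empty X)
  exfalso
  obtain ⟨Y, hYS, hYmax⟩ := exists_max_image S card hS
  have hYℬ : Y ∈ ℬ := (mem_filter.mp hYS).1
  have hκY : κ Y ≠ 0 := (mem_filter.mp hYS).2
  -- every strict superset of `Y` in `ℬ` has `κ = 0`
  have hzero : ∀ X ∈ ℬ.filter (fun X => Y ⊆ X), X ≠ Y → κ X = 0 := by
    intro X hX hXY
    obtain ⟨hXℬ, hYX⟩ := mem_filter.mp hX
    by_contra hκX
    have hXS : X ∈ S := mem_filter.mpr ⟨hXℬ, hκX⟩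
    have hcard : #X ≤ #Y := hYmax X hXS
    exact hXY (eq_of_subset_of_card_le hYX hcard).symm
  have hsum := h Y hYℬ
  have hYmem : Y ∈ ℬ.filter (fun X => Y ⊆ X) := mem_filter.mpr ⟨hYℬ, subset_rfl⟩
  rw [← add_sum_erase _ _ hYmem] at hsum
  have hrest : ∑ X ∈ (ℬ.filter (fun X => Y ⊆ X)).erase Y, κ X = 0 :=
    sum_eq_zero fun X hX => hzero X (mem_of_mem_erase hX) (ne_of_mem_erase hX)
  rw [hrest, add_zero] at hsum
  exact hκY hsum

/-- **THEOREM F (structure of the relations of a framed family).**  Let `∅ ∈ 𝒜`, `T ∈ 𝒜` and `A ⊆ T` for all `A ∈ 𝒜`.  If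
`∑_A λ_A [E ⊆ A] = ∑_A μ_A [E ∩ A = ∅]` for every `E ∈ 𝒜 \\ 𝒜`, then: `λ A = 0` and `μ A = 0` for every member `A` whose complement
`T \ A` is not a member, and `μ A = λ B` whenever `B = T \ A` is a member.  (Only the member columns `B` and the co-member columns
`T \ B` are used.) -/
theorem framed_relation (𝒜 : Finset (Finset α)) (T : Finset α) (h0 : (∅ : Finset α) ∈ 𝒜) (hT : T ∈ 𝒜)
    (hsub : ∀ A ∈ 𝒜, A ⊆ T) (l m : ↥𝒜 → K)
    (h1 : ∀ E ∈ 𝒜 \\ 𝒜, ∑ A : 𝒜, l A * (if E ⊆ (A : Finset α) then (1 : K) else 0) =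
        ∑ A : 𝒜, m A * (if Disjoint E (A : Finset α) then (1 : K) else 0)) :
    (∀ A : 𝒜, T \ (A : Finset α) ∉ 𝒜 → l A = 0 ∧ m A = 0) ∧
    (∀ A B : 𝒜, (B : Finset α) = T \ (A : Finset α) → m A = l B) := by
  classical
  -- extensions of `l`, `m` to all sets, and the coefficient function `κ`
  let lv : Finset α → K := fun X => if hX : X ∈ 𝒜 then l ⟨X, hX⟩ else 0
  let mv : Finset α → K := fun X => if hX : X ⊆ T ∧ T \ X ∈ 𝒜 then m ⟨T \ X, hX.2⟩ else 0
  have hlv : ∀ A : 𝒜, lv A = l A := fun A => by simp only [lv, dif_pos A.2]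
  have hmv : ∀ A : 𝒜, mv (T \ (A : Finset α)) = m A := by
    intro A
    have hA : T \ (T \ (A : Finset α)) = A := by
      rw [sdiff_sdiff_right_self, inf_eq_inter, inter_eq_right.mpr (hsub A A.2)]
    have hc : T \ (A : Finset α) ⊆ T ∧ T \ (T \ (A : Finset α)) ∈ 𝒜 := ⟨sdiff_subset, by rw [hA]; exact A.2⟩
    simp only [mv, dif_pos hc]
    congr 1
    exact Subtype.ext hA
  let κ : Finset α → K := fun X => lv X - mv X
  let ℬ : Finset (Finset α) := 𝒜 ∪ 𝒜.image (fun A => T \ A)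
  -- the `l`-part of the sum over supersets is the containment sum
  have suml : ∀ Y, ∑ X ∈ ℬ.filter (fun X => Y ⊆ X), lv X =
      ∑ A : 𝒜, l A * (if Y ⊆ (A : Finset α) then (1 : K) else 0) := by
    intro Y
    have h2 : ∑ X ∈ ℬ.filter (fun X => Y ⊆ X), lv X = ∑ X ∈ ℬ, (if Y ⊆ X then lv X else 0) := by
      rw [sum_filter]
    have h3 : ∑ X ∈ ℬ, (if Y ⊆ X then lv X else 0) = ∑ X ∈ 𝒜, (if Y ⊆ X then lv X else 0) := by
      symm
      refine sum_subset subset_union_left fun X hXℬ hX𝒜 => ?_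
      have : lv X = 0 := by simp only [lv, dif_neg hX𝒜]
      simp [this]
    have h4 : ∑ X ∈ 𝒜, (if Y ⊆ X then lv X else 0) = ∑ A : 𝒜, (if Y ⊆ (A : Finset α) then lv A else 0) :=
      (Finset.sum_coe_sort 𝒜 (fun X => if Y ⊆ X then lv X else 0)).symm
    rw [h2, h3, h4]
    refine sum_congr rfl fun A _ => ?_
    rw [hlv A]
    split_ifs <;> simp
  -- the `m`-part is the disjointness sum (for `Y ⊆ T`)
  have summ : ∀ Y, Y ⊆ T → ∑ X ∈ ℬ.filter (fun X => Y ⊆ X), mv X =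
      ∑ A : 𝒜, m A * (if Disjoint Y (A : Finset α) then (1 : K) else 0) := by
    intro Y hYT
    have h2 : ∑ X ∈ ℬ.filter (fun X => Y ⊆ X), mv X = ∑ X ∈ ℬ, (if Y ⊆ X then mv X else 0) := by
      rw [sum_filter]
    have himg : 𝒜.image (fun A => T \ A) ⊆ ℬ := subset_union_right
    have h3 : ∑ X ∈ ℬ, (if Y ⊆ X then mv X else 0) =
        ∑ X ∈ 𝒜.image (fun A => T \ A), (if Y ⊆ X then mv X else 0) := by
      symm
      refine sum_subset himg fun X hXℬ hXim => ?_
      have : mv X = 0 := by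
        simp only [mv]
        rw [dif_neg]
        rintro ⟨hXT, hTX⟩
        apply hXim
        refine mem_image.mpr ⟨T \ X, hTX, ?_⟩
        rw [sdiff_sdiff_right_self, inf_eq_inter, inter_eq_right.mpr hXT]
      simp [this]
    have hinj : Set.InjOn (fun A => T \ A) (𝒜 : Set (Finset α)) := by
      intro A hA B hB hAB
      have hA' : T \ (T \ A) = A := by
        rw [sdiff_sdiff_right_self, inf_eq_inter, inter_eq_right.mpr (hsub A hA)]
      have hB' : T \ (T \ B) = B := by
        rw [sdiff_sdiff_right_self, inf_eq_inter, inter_eq_right.mpr (hsub B hB)]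
      have := congrArg (fun X => T \ X) hAB
      simp only at this
      rwa [hA', hB'] at this
    have h4 : ∑ X ∈ 𝒜.image (fun A => T \ A), (if Y ⊆ X then mv X else 0) =
        ∑ A ∈ 𝒜, (if Y ⊆ T \ A then mv (T \ A) else 0) := sum_image hinj
    have h5 : ∑ A ∈ 𝒜, (if Y ⊆ T \ A then mv (T \ A) else 0) =
        ∑ A : 𝒜, (if Y ⊆ T \ (A : Finset α) then mv (T \ (A : Finset α)) else 0) :=
      (Finset.sum_coe_sort 𝒜 (fun A => if Y ⊆ T \ A then mv (T \ A) else 0)).symm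
    rw [h2, h3, h4, h5]
    refine sum_congr rfl fun A _ => ?_
    rw [hmv A]
    have hiff : Y ⊆ T \ (A : Finset α) ↔ Disjoint Y (A : Finset α) := by
      rw [subset_sdiff]; exact ⟨fun h => h.2, fun h => ⟨hYT, h⟩⟩
    by_cases hd : Disjoint Y (A : Finset α)
    · rw [if_pos (hiff.mpr hd), if_pos hd, mul_one]
    · rw [if_neg (fun h => hd (hiff.mp h)), if_neg hd, mul_zero]
  -- every member of `ℬ` is a column of `𝒜 \\ 𝒜` and lies in `T`
  have hℬD : ∀ Y ∈ ℬ, Y ∈ 𝒜 \\ 𝒜 ∧ Y ⊆ T := by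
    intro Y hY
    rcases mem_union.mp hY with hY𝒜 | hYim
    · exact ⟨mem_diffs.mpr ⟨Y, hY𝒜, ∅, h0, sdiff_empty⟩, hsub Y hY𝒜⟩
    · obtain ⟨A, hA, rfl⟩ := mem_image.mp hYim
      exact ⟨mem_diffs.mpr ⟨T, hT, A, hA, rfl⟩, sdiff_subset⟩
  -- `κ` has vanishing superset sums over `ℬ`
  have hκ : ∀ Y ∈ ℬ, ∑ X ∈ ℬ.filter (fun X => Y ⊆ X), κ X = 0 := by
    intro Y hY
    obtain ⟨hYD, hYT⟩ := hℬD Y hY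
    show ∑ X ∈ ℬ.filter (fun X => Y ⊆ X), (lv X - mv X) = 0
    rw [sum_sub_distrib, suml Y, summ Y hYT, h1 Y hYD, sub_self]
  have hκ0 := eq_zero_of_sum_supsets_eq_zero ℬ κ hκ
  refine ⟨fun A hA => ?_, fun A B hB => ?_⟩
  · -- `T \ A ∉ 𝒜`: `κ A = l A` and `κ (T \ A) = - m A`
    have hAℬ : (A : Finset α) ∈ ℬ := mem_union_left _ A.2
    have hTAℬ : T \ (A : Finset α) ∈ ℬ := mem_union_right _ (mem_image.mpr ⟨A, A.2, rfl⟩)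
    have e1 := hκ0 _ hAℬ
    have e2 := hκ0 _ hTAℬ
    have hmvA : mv (A : Finset α) = 0 := by
      simp only [mv]
      rw [dif_neg]
      rintro ⟨-, h⟩
      exact hA h
    have hlvTA : lv (T \ (A : Finset α)) = 0 := by simp only [lv, dif_neg hA]
    constructor
    · have : κ (A : Finset α) = lv A - mv A := rfl
      rw [this, hmvA, sub_zero, hlv A] at e1
      exact e1
    · have : κ (T \ (A : Finset α)) = lv (T \ (A : Finset α)) - mv (T \ (A : Finset α)) := rfl
      rw [this, hlvTA, zero_sub, hmv A, neg_eq_zero] at e2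
      exact e2
  · -- `B = T \ A ∈ 𝒜`: `κ B = l B - m A`
    have hBℬ : (B : Finset α) ∈ ℬ := mem_union_left _ B.2
    have e := hκ0 _ hBℬ
    have : κ (B : Finset α) = lv B - mv B := rfl
    rw [this, hlv B, hB, hmv A, sub_eq_zero] at e
    exact e.symm

/-- **Framed families have the 2-chain periodicity property (P2)**: if `λZ = μY` and `μZ = νY` on `𝒜 \\ 𝒜`, then `λ = ν`. -/
theorem twoChain_of_framed (𝒜 : Finset (Finset α)) (T : Finset α) (h0 : (∅ : Finset α) ∈ 𝒜) (hT : T ∈ 𝒜)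
    (hsub : ∀ A ∈ 𝒜, A ⊆ T) (l m n : ↥𝒜 → K)
    (h1 : ∀ E ∈ 𝒜 \\ 𝒜, ∑ A : 𝒜, l A * (if E ⊆ (A : Finset α) then (1 : K) else 0) =
        ∑ A : 𝒜, m A * (if Disjoint E (A : Finset α) then (1 : K) else 0))
    (h2 : ∀ E ∈ 𝒜 \\ 𝒜, ∑ A : 𝒜, m A * (if E ⊆ (A : Finset α) then (1 : K) else 0) =
        ∑ A : 𝒜, n A * (if Disjoint E (A : Finset α) then (1 : K) else 0)) : l = n := by
  classical
  obtain ⟨hz1, hc1⟩ := framed_relation 𝒜 T h0 hT hsub l m h1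
  obtain ⟨hz2, hc2⟩ := framed_relation 𝒜 T h0 hT hsub m n h2
  funext A
  by_cases hA : T \ (A : Finset α) ∈ 𝒜
  · -- `A` and `B = T \ A` are both members: `m A = l B`, `n A = m B`, `m B = l A`
    let B : ↥𝒜 := ⟨T \ (A : Finset α), hA⟩
    have hBA : (A : Finset α) = T \ (B : Finset α) := by
      show (A : Finset α) = T \ (T \ (A : Finset α))
      rw [sdiff_sdiff_right_self, inf_eq_inter, inter_eq_right.mpr (hsub A A.2)]
    have e1 : m B = l A := hc1 B A hBA
    have e2 : n A = m B := hc2 A B rfl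
    rw [e2, e1]
  · rw [(hz1 A hA).1, (hz2 A hA).2]

/-- **The Marica–Schönheim pencil theorem over every field for framed families.**  If `∅ ∈ 𝒜`, `T ∈ 𝒜` and every member of
`𝒜` lies in `T`, then for every field `K` and every `t ∈ K` with `t * t ≠ 1` the pencil rows
`A ↦ (E ↦ [E ⊆ A] + t [E ∩ A = ∅])` over `𝒜 \\ 𝒜` are linearly independent over `K`. -/
theorem linearIndependent_pencil_of_framed (𝒜 : Finset (Finset α)) (T : Finset α) (h0 : (∅ : Finset α) ∈ 𝒜)
    (hT : T ∈ 𝒜) (hsub : ∀ A ∈ 𝒜, A ⊆ T) {t : K} (ht : t * t ≠ 1) :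
    LinearIndependent K (fun A : 𝒜 => fun E : (𝒜 \\ 𝒜 : Finset (Finset α)) =>
      (if (E : Finset α) ⊆ (A : Finset α) then (1 : K) else 0) +
        t * (if Disjoint (E : Finset α) (A : Finset α) then (1 : K) else 0)) := by
  classical
  rw [Fintype.linearIndependent_iff]
  intro c hc
  have hdep : ∀ E ∈ 𝒜 \\ 𝒜, ∑ A : 𝒜, c A * (if E ⊆ (A : Finset α) then (1 : K) else 0) +
      t * ∑ A : 𝒜, c A * (if Disjoint E (A : Finset α) then (1 : K) else 0) = 0 := by
    intro E hE
    have h := congr_fun hc ⟨E, hE⟩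
    simp only [Finset.sum_apply, Pi.smul_apply, smul_eq_mul, Pi.zero_apply] at h
    have e : ∑ A : 𝒜, c A * (if E ⊆ (A : Finset α) then (1 : K) else 0) +
        t * ∑ A : 𝒜, c A * (if Disjoint E (A : Finset α) then (1 : K) else 0) =
        ∑ A : 𝒜, c A * ((if E ⊆ (A : Finset α) then (1 : K) else 0) +
          t * (if Disjoint E (A : Finset α) then (1 : K) else 0)) := by
      rw [mul_sum, ← sum_add_distrib]
      refine sum_congr rfl fun A _ => ?_
      ring
    rw [e]
    exact h
  -- the relation `(c, -t c)`
  have h1 : ∀ E ∈ 𝒜 \\ 𝒜, ∑ A : 𝒜, c A * (if E ⊆ (A : Finset α) then (1 : K) else 0) =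
      ∑ A : 𝒜, (-t * c A) * (if Disjoint E (A : Finset α) then (1 : K) else 0) := by
    intro E hE
    have h := hdep E hE
    have e2 : ∑ A : 𝒜, (-t * c A) * (if Disjoint E (A : Finset α) then (1 : K) else 0) =
        -t * ∑ A : 𝒜, c A * (if Disjoint E (A : Finset α) then (1 : K) else 0) := by
      rw [mul_sum]; refine sum_congr rfl fun A _ => ?_; ring
    rw [e2]; linear_combination h
  obtain ⟨hz, hcpl⟩ := framed_relation 𝒜 T h0 hT hsub c (fun A => -t * c A) h1
  intro A
  by_cases hA : T \ (A : Finset α) ∈ 𝒜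
  · let B : ↥𝒜 := ⟨T \ (A : Finset α), hA⟩
    have hBA : (A : Finset α) = T \ (B : Finset α) := by
      show (A : Finset α) = T \ (T \ (A : Finset α))
      rw [sdiff_sdiff_right_self, inf_eq_inter, inter_eq_right.mpr (hsub A A.2)]
    have e1 : -t * c A = c B := hcpl A B rfl
    have e2 : -t * c B = c A := hcpl B A hBA
    have h3 : (1 - t * t) * c A = 0 := by linear_combination t * e1 - e2
    rcases mul_eq_zero.mp h3 with h4 | h4
    · exact absurd (by linear_combination -h4) ht
    · exact h4
  · exact (hz A hA).1

end OrderedDifferences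

end Summit.CriticalPhenomena.PercolationContinuityZ3.Theorems
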